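import Literature.MathematicalPhysics.QuantumLattice.SectorPartitionFnGrandCanonicalBound
import Literature.MathematicalPhysics.QuantumLattice.TorusSectorGibbsEntropyRowPressureNumber
import HarnessLib

/-!
# A grand-canonical pressure ceiling at any chemical potential caps the canonical thermal pressure:
# `p(β; t,t',U; n) + βμn ≤ q`

Topic `MathematicalPhysics/QuantumLattice` (family `hubbard`); the number form of
`SectorPartitionFnGrandCanonicalBound.lean` ("any certified upper bound on the grand-canonical torus pressure at
`β_h` (any `μ`) is a valid `u_h`") on the thermal pressure of record `p = pressureTT' β t t' U n`
(`HubbardTTPrimeThermalPressureLimit.lean`). The grand-canonical controls of the Hubbard pressure in the tree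
(high-temperature / cluster expansions: `HubbardLatticeAnalytic`, `HubbardPolymerBounds`,
`HubbardTorusSingleScalePressure`) are ceilings on `log Re Z_β(H_L − μN)`; since `e^{βμN} Z_β(H_L; k,k) ≤ Z_β(H_L − μN)`
(Peierls) and `N = rectN n L = nL² + O(1)`:

* `pressureTT'_add_le_of_grandCanonical_ceiling` — if along ONE side sequence `Ls → ∞`, for every `ε > 0`
  eventually `log Re Z_β(H_{Ls j} − μN) ≤ (q + ε)(Ls j)²`, then `p(β; t,t',U; n) + βμn ≤ q` (`β ≥ 0`, `U ≥ 0`,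
  `0 ≤ n < 2`, any real `μ`);
* `pressureTT'_add_le_of_grandCanonical_ceiling'` — the `ε`-free form.

Not here: the Legendre EQUALITY `sup_n (p + βμn) = p_GC` (it needs the limit for general spin sectors and is
not claimed).

Everything is PROVED; no definition, no named fact.

## Mathlib / tree search

REUSED: `log_partitionFn_sectorHamiltonianTT'_le_grandCanonical` (`SectorPartitionFnGrandCanonicalBound`),
`pressureTT'_le_of_eventually_subseq` (`TorusSectorGibbsEntropyRowPressureNumber`), `rectN_le`, `lt_rectN_add_two`.
`lean search 'pressureTT.*grandCanonical'`: nothing (2026-08-27).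

## References

* D. Ruelle, *Statistical Mechanics: Rigorous Results* (1969), §3.4. [cite: Ruelle1969, §3.4]
* R. B. Israel, *Convexity in the Theory of Lattice Gases* (1979), Lemma II.3.1. [cite: Israel1979, Lemma II.3.1]
-/

noncomputable section

namespace Literature.MathematicalPhysics.QuantumLattice

open Matrix Finset HubbardWave0 LiebThm1
open _root_.Filter
open scoped _root_.Topology ComplexOrder BigOperators

namespace ThermodynamicLimit

variable {β : ℝ} (hβ : 0 ≤ β) (t t' : ℝ) {U : ℝ} (hU : 0 ≤ U) {n : ℝ} (hn0 : 0 ≤ n) (hn2 : n < 2)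
include hβ hU hn0 hn2

/-- **A grand-canonical ceiling caps the canonical pressure**: if along a side sequence `Ls → ∞`, for every
`ε > 0` eventually `log Re Z_β(H_{L} − μN) ≤ (q + ε) L²` (`L = Ls j`), then `p(β; t,t',U; n) + βμn ≤ q`.
[cite: Ruelle1969, §3.4] [cite: Israel1979, Lemma II.3.1] -/
theorem pressureTT'_add_le_of_grandCanonical_ceiling {Ls : ℕ → ℕ} (hLs : Tendsto Ls atTop atTop) {μ q : ℝ}
    (hq : ∀ ε : ℝ, 0 < ε → ∀ᶠ j in atTop,
      Real.log (partitionFn β (hubbardTorusTT' (Ls j) t t' U - (μ : ℂ) • totalNumber)).re ≤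
        (q + ε) * (Ls j : ℝ) ^ 2) :
    pressureTT' β t t' U n + β * μ * n ≤ q := by
  suffices h : pressureTT' β t t' U n ≤ q - β * μ * n by linarith
  refine pressureTT'_le_of_eventually_subseq hβ t t' hU hn0 hn2 hLs fun ε hε => ?_
  have hε2 : 0 < ε / 2 := by linarith
  -- eventually `2|βμ| ≤ (ε/2) L²`
  have hbig : ∀ᶠ j in atTop, 2 * |β * μ| ≤ ε / 2 * (Ls j : ℝ) ^ 2 := by
    have hT : Tendsto (fun j => ε / 2 * (Ls j : ℝ) ^ 2) atTop atTop :=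
      Tendsto.const_mul_atTop hε2 ((tendsto_pow_atTop (n := 2) two_ne_zero).comp
        (tendsto_natCast_atTop_atTop.comp hLs))
    exact hT.eventually_ge_atTop _
  filter_upwards [hq (ε / 2) hε2, hbig] with j hj hb
  have hgc := log_partitionFn_sectorHamiltonianTT'_le_grandCanonical t t' U hn0 hn2.le (Ls j) β μ
  have h1 := rectN_le hn0 (Ls j)
  have h2 := lt_rectN_add_two n (Ls j)
  -- `|βμ (rectN − nL²)| ≤ 2|βμ|`
  have hdev : -(β * μ * (rectN n (Ls j) : ℕ)) ≤ -(β * μ * n) * (Ls j : ℝ) ^ 2 + 2 * |β * μ| := by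
    have e : -(β * μ * (rectN n (Ls j) : ℕ)) - (-(β * μ * n) * (Ls j : ℝ) ^ 2) =
        (β * μ) * (n * (Ls j : ℝ) ^ 2 - rectN n (Ls j)) := by ring
    have hd : |n * (Ls j : ℝ) ^ 2 - rectN n (Ls j)| ≤ 2 := by rw [abs_le]; constructor <;> linarith
    have hle : (β * μ) * (n * (Ls j : ℝ) ^ 2 - rectN n (Ls j)) ≤ 2 * |β * μ| := by
      calc (β * μ) * (n * (Ls j : ℝ) ^ 2 - rectN n (Ls j)) ≤ |(β * μ) * (n * (Ls j : ℝ) ^ 2 - rectN n (Ls j))| :=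
            le_abs_self _
        _ = |β * μ| * |n * (Ls j : ℝ) ^ 2 - rectN n (Ls j)| := abs_mul _ _
        _ ≤ |β * μ| * 2 := mul_le_mul_of_nonneg_left hd (abs_nonneg _)
        _ = 2 * |β * μ| := mul_comm _ _
    linarith
  have e2 : (q - β * μ * n + ε) * (Ls j : ℝ) ^ 2 =
      (q + ε / 2) * (Ls j : ℝ) ^ 2 + -(β * μ * n) * (Ls j : ℝ) ^ 2 + ε / 2 * (Ls j : ℝ) ^ 2 := by ring
  rw [e2]
  linarith

/-- `ε`-free form: an exact ceiling `log Re Z_β(H_L − μN) ≤ q L²` eventually along one `Ls → ∞` gives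
`p(β; t,t',U; n) + βμn ≤ q`. [cite: Ruelle1969, §3.4] -/
theorem pressureTT'_add_le_of_grandCanonical_ceiling' {Ls : ℕ → ℕ} (hLs : Tendsto Ls atTop atTop) {μ q : ℝ}
    (hq : ∀ᶠ j in atTop,
      Real.log (partitionFn β (hubbardTorusTT' (Ls j) t t' U - (μ : ℂ) • totalNumber)).re ≤ q * (Ls j : ℝ) ^ 2) :
    pressureTT' β t t' U n + β * μ * n ≤ q :=
  pressureTT'_add_le_of_grandCanonical_ceiling hβ t t' hU hn0 hn2 hLs fun _ hε =>
    hq.mono fun _ hL => hL.trans (mul_le_mul_of_nonneg_right (le_add_of_nonneg_right hε.le) (sq_nonneg _))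

end ThermodynamicLimit

end Literature.MathematicalPhysics.QuantumLattice
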